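import Mathlib
import Summits.MatrixMultiplication.Statement
import Summits.MatrixMultiplication.MatrixMultiplication.Theorems.GraphEquationsIsotropicKernel

/-!
# Graph equations — `ω₃ = ω`: the cubic verification exponent equals the exponent of matrix
# multiplication (M68)

Headline form of M66 (`cubicEquationsForceMultiplication`) on the degree dials of M53
(`GraphEquationsDegreeDials`: `2 ≤ ω_v ≤ ω₃ ≤ ω₂ = ω`):

* **`omegaCubic_eq_omega : omegaCubic = omega ℂ`** — correct non-adaptive polynomial verification of
  `n × n` matrix products by tests of total degree `≤ 3` is exactly as hard as multiplication;
* the dial chain collapses to `2 ≤ ω_v ≤ ω₃ = ω₂ = ω` (`degree_dial_chain'`);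
* `cubicDegreeReduction_iff_omega_le_omegaVerif : CubicDegreeReduction ↔ ω ≤ ω_v`, i.e. the two
  remaining open statements of the route's crux coincide: `CDR ↔ MultiplicityReduction ↔ [ω = ω_v]`.
-/

set_option linter.dupNamespace false

noncomputable section

namespace Summit.MatrixMultiplication.MatrixMultiplication.Theorems.GraphEquations

open Literature.Computability.AlgebraicComplexity

/-- **`ω₃ = ω`.** -/
theorem omegaCubic_eq_omega : omegaCubic = omega ℂ :=
  cubicEquationsForceMultiplication_iff_eq.mp cubicEquationsForceMultiplication

/-- `ω₃ = ω₂`. -/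
theorem omegaCubic_eq_omegaQuad : omegaCubic = omegaQuad := by
  rw [omegaCubic_eq_omega, omegaQuad_eq_omega]

/-- The collapsed dial chain `2 ≤ ω_v ≤ ω₃ = ω₂ = ω < 2.48`. -/
theorem degree_dial_chain' :
    2 ≤ omegaVerif ∧ omegaVerif ≤ omegaCubic ∧ omegaCubic = omegaQuad ∧ omegaQuad = omega ℂ ∧
      omega ℂ < 2.48 :=
  ⟨two_le_omegaVerif, omegaVerif_le_omegaCubic, omegaCubic_eq_omegaQuad, omegaQuad_eq_omega,
    degree_dial_chain.2.2.2.2⟩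

/-- `CDR ↔ ω ≤ ω_v`: after `ω₃ = ω` the degree-reduction half of the crux IS `[ω = ω_v]`. -/
theorem cubicDegreeReduction_iff_omega_le_omegaVerif :
    CubicDegreeReduction ↔ omega ℂ ≤ omegaVerif := by
  rw [cubicDegreeReduction_iff, omegaCubic_eq_omega]

/-- `CDR ↔ ω = ω_v`. -/
theorem cubicDegreeReduction_iff_omega_eq_omegaVerif :
    CubicDegreeReduction ↔ omega ℂ = omegaVerif := by
  rw [cubicDegreeReduction_iff_omega_le_omegaVerif]
  exact ⟨fun h => le_antisymm h omegaVerif_le_omega, fun h => h.le⟩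

end Summit.MatrixMultiplication.MatrixMultiplication.Theorems.GraphEquations
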